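import Summits.HodgeConjecture.HodgeConjecture.Theorems.BiquadraticSecantLiftDefs
import Summits.HodgeConjecture.HodgeConjecture.Theorems.BiquadraticSecantLiftHyperplanePair
import Literature.AlgebraicGeometry.HodgeTheory.KaehlerClassPullback
import Literature.AlgebraicGeometry.Deligne1982.ProductPolarizationKaehlerCM
import Literature.NumberTheory.ComplexMultiplication.CMTypeRealisationPowerInducedType
import HarnessLib

/-!
# BiquadraticSecantLift · X2 — the product polarization `π₀^* k + m·π₁^* k` on `⨁_{Fin 2} A` is a Kähler multiple

Helper file for crux X2 `BiquadraticBaseChangeHyperbolic` (stmt-HodgeConjecture-22133) of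
route-HodgeConjecture-BiquadraticSecantLift (part 2, sequel of `…HyperplanePair`): the POLARIZATION of the twelvefold
`B = ⨁_{Fin 2} A` («`E_A ⊕ m·E_A`» of the route text), on the tree's carriers (`HodgeTheory.IsKaehlerClass`, model-free).
For a complex abelian variety `A` with `φ : A ⟶ A`, `d ≥ 1`, `m ≥ 2`, a projective embedding `e` of `B` and a rational
class `a ≠ 0` on `ℙᴺ`:

* §2 `exists_isKaehlerClass_smul_restrictions` — `κ = ι₀^*(e^*a) + ι₁^*(e^*a) ∈ H²(A)`, the sum of the two hyperplane
  classes of `A` along the closed immersions `ιⱼ ≫ e : A ⟶ B ⟶ ℙᴺ`, is a non-zero real multiple of a Kähler class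
  (one scalar for both, `exists_real_map_eq_smul_of_pullback_eq_fubiniStudy_pair`), and so is `k = d·κ + φ^*κ`;
* §3 `exists_isKaehlerClass_smul_prodClass` — **`h₂ = π₀^* k + m·π₁^* k` is a non-zero real multiple of a Kähler class
  of `B`**: `h_s = e^*a + σ^*e^*a` (`σ` the swap) is a Kähler multiple (`smul_add_map`), its block-diagonal part
  `Σⱼ (πⱼ ≫ ιⱼ)^* h_s = π₀^*κ + π₁^*κ` is one (`Deligne1982.isKaehlerClass_sum_map_blockProjection`),
  `c·(π₀^*κ + π₁^*κ) + shift^*(π₀^*κ + π₁^*κ) = c·π₀^*κ + (c+1)·π₁^*κ` with `c = 1/(m-1)` is one (`smul_add_map` along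
  `shift : (x, y) ↦ (y, 0)`), i.e. `π₀^*κ + m·π₁^*κ` is, and finally `d·(…) + (φ⊕φ)^*(…) = π₀^*k + m·π₁^*k`.

No product-of-Kähler-manifolds statement and no restriction-of-Kähler-forms statement is used. Nothing here is a case of
the Hodge conjecture (HC is NOT proved; X2 is not proved by this file).

## References
[cite: VoisinHodgeI2002, §3.1.3, §7.1.2, Thm. 7.10] [cite: Deligne1982HodgeCycles, §5 (c) p. 39 («θ = Σ fᵢθᵢ is a polarization»)]
[cite: LangeBirkenhake1992, §5.2–5.3] [cite: MumfordAV1970, §19]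
-/

-- every declaration of this problem lives in `Summit.HodgeConjecture.HodgeConjecture.…` (summit = sub-problem)
set_option linter.dupNamespace false

noncomputable section

open scoped Manifold ContDiff
open CategoryTheory CategoryTheory.Limits AlgebraicGeometry
open Literature.AlgebraicTopology.SingularHomology Literature.Geometry.Kaehler
open Literature.NumberTheory.Transcendental
open Literature.AlgebraicGeometry.HodgeTheory
open Literature.AlgebraicGeometry.Motives (AbelianVariety projectiveSpace ComplexPoints IsSmoothProjective ProjectiveEmbedding)
open Literature.AlgebraicGeometry.Motives.AnalytificationKaehler (fubiniStudyPullbackForm)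

namespace Summit.HodgeConjecture.HodgeConjecture.BiquadraticSecantLift

/-! ## §2 The restrictions `ι₀^*(e^*a) + ι₁^*(e^*a)` on `A` -/

section Restrictions

variable (A : AbelianVariety ℂ)

/-- The inclusions `ιⱼ : A ⟶ ⨁_{Fin 2} A` are closed immersions (sections of the separated projections `πⱼ`). -/
theorem isClosedImmersion_biproduct_ι (j : Fin 2) :
    IsClosedImmersion (AbelianVariety.Hom.toSchemeHom (biproduct.ι (fun _ : Fin 2 => A) j)) :=
  Literature.NumberTheory.ComplexMultiplication.CMPower.isClosedImmersion_toSchemeHom_of_comp_eq_id _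
    (biproduct.π (fun _ : Fin 2 => A) j) (biproduct.ι_π_self _ j)

/-- The composite `A ⟶ ⨁_{Fin 2} A ⟶ ℙᴺ` of `ιⱼ` with a projective embedding of the twelvefold is a closed immersion. -/
theorem isClosedImmersion_ι_comp_embedding (e : ProjectiveEmbedding (twelvefold A).X) (j : Fin 2) :
    IsClosedImmersion ((biproduct.ι (fun _ : Fin 2 => A) j).hom.hom.hom ≫ e.ι).left := by
  haveI := isClosedImmersion_biproduct_ι A j
  rw [Over.comp_left]
  exact IsClosedImmersion.comp _ _

/-- Pull-back along the composite embedding is the restriction of the hyperplane class: `(ιⱼ ≫ e)^* a = ιⱼ^* (e^* a)`. -/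
theorem map_ι_comp_embedding (e : ProjectiveEmbedding (twelvefold A).X) (j : Fin 2)
    (a : complexBetti (projectiveSpace e.n ℂ) 2) :
    complexBetti.map ((biproduct.ι (fun _ : Fin 2 => A) j).hom.hom.hom ≫ e.ι) 2 a =
      complexBetti.map (biproduct.ι (fun _ : Fin 2 => A) j).hom.hom.hom 2 (complexBetti.map e.ι 2 a) := by
  rw [complexBetti.map_comp, CategoryTheory.comp_apply]

/-- **`κ = ι₀^*(e^*a) + ι₁^*(e^*a)` is a non-zero real multiple of a Kähler class of `A`** (`a ≠ 0` rational on `ℙᴺ`,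
`e` a projective embedding of `⨁_{Fin 2} A`): the two summands are the hyperplane classes of the closed immersions
`ι₀ ≫ e`, `ι₁ ≫ e`, equal to the SAME real multiple `s` of the Kähler classes `H₀`, `H₁` of one Hodge model of `A`
(`exists_real_map_eq_smul_of_pullback_eq_fubiniStudy_pair`), and `H₀ + H₁` is Kähler. -/
theorem exists_isKaehlerClass_smul_restrictions (hA : 0 < A.dim) (e : ProjectiveEmbedding (twelvefold A).X)
    {a : complexBetti (projectiveSpace e.n ℂ) 2} (ha : IsRationalClass a) (ha0 : a ≠ 0) :
    ∃ t : ℝ, t ≠ 0 ∧ IsKaehlerClass A.dim A.X ((t : ℂ) •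
      (complexBetti.map (biproduct.ι (fun _ : Fin 2 => A) 0).hom.hom.hom 2 (complexBetti.map e.ι 2 a) +
        complexBetti.map (biproduct.ι (fun _ : Fin 2 => A) 1).hom.hom.hom 2 (complexBetti.map e.ι 2 a))) := by
  have hX : IsSmoothProjective A.dim A.X := Literature.AlgebraicGeometry.Motives.AbelianVariety.isSmoothProjective_holds
  obtain ⟨M⟩ := nonempty_hodgeModel_holds.nonempty hX
  obtain ⟨eR, heR, hem, -⟩ := exists_deRhamIsoFamily_holds M.model
  haveI := isClosedImmersion_ι_comp_embedding A e 0
  haveI := isClosedImmersion_ι_comp_embedding A e 1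
  have hθ₀ := M.fubiniStudyPullbackForm_mem_closedSmoothForms ((biproduct.ι (fun _ : Fin 2 => A) 0).hom.hom.hom ≫ e.ι)
  have hθ₁ := M.fubiniStudyPullbackForm_mem_closedSmoothForms ((biproduct.ι (fun _ : Fin 2 => A) 1).hom.hom.hom ≫ e.ι)
  obtain ⟨H₀, hH₀⟩ := M.pullback_surjective 2 (ofRealClass M.carrier 2 (eR M.carrier 2
    (deRhamCohomology.mk ⟨fubiniStudyPullbackForm M.model ((biproduct.ι (fun _ : Fin 2 => A) 0).hom.hom.hom ≫ e.ι)
      M.toComplexPoints, hθ₀⟩)))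
  obtain ⟨H₁, hH₁⟩ := M.pullback_surjective 2 (ofRealClass M.carrier 2 (eR M.carrier 2
    (deRhamCohomology.mk ⟨fubiniStudyPullbackForm M.model ((biproduct.ι (fun _ : Fin 2 => A) 1).hom.hom.hom ≫ e.ι)
      M.toComplexPoints, hθ₁⟩)))
  have hK₀ : M.IsKaehlerClassVia eR H₀ := M.isKaehlerClassVia_of_pullback_eq_fubiniStudyPullbackForm eR hX _ hθ₀ hH₀
  have hK₁ : M.IsKaehlerClassVia eR H₁ := M.isKaehlerClassVia_of_pullback_eq_fubiniStudyPullbackForm eR hX _ hθ₁ hH₁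
  obtain ⟨s, hs0, hs₀, hs₁⟩ := exists_real_map_eq_smul_of_pullback_eq_fubiniStudy_pair hX (Nat.one_le_iff_ne_zero.2 hA.ne')
    M _ _ eR heR hθ₀ hθ₁ hH₀ hH₁ ha ha0
  refine ⟨s⁻¹, inv_ne_zero hs0, ?_⟩
  rw [← map_ι_comp_embedding, ← map_ι_comp_embedding, hs₀, hs₁, ← smul_add, smul_smul, Complex.ofReal_inv,
    inv_mul_cancel₀ (Complex.ofReal_ne_zero.2 hs0), one_smul]
  exact IsKaehlerClass.add_of_isKaehlerClassVia hK₀ hK₁ heR hem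

variable {A}

/-- **`k = d·κ + φ^*κ` is a non-zero real multiple of a Kähler class** whenever `κ` is (`d ≥ 1`; the tree's
`IsKaehlerClass.smul_add_map`). -/
theorem exists_isKaehlerClass_smul_ksymm (φ : A ⟶ A) {d : ℕ} (hd : 0 < d) {κ : complexBetti A.X 2}
    (hκ : ∃ t : ℝ, t ≠ 0 ∧ IsKaehlerClass A.dim A.X ((t : ℂ) • κ)) :
    ∃ t : ℝ, t ≠ 0 ∧ IsKaehlerClass A.dim A.X ((t : ℂ) • ((d : ℂ) • κ + complexBetti.map φ.hom.hom.hom 2 κ)) := by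
  obtain ⟨t, ht0, htK⟩ := hκ
  refine ⟨t, ht0, ?_⟩
  have h := htK.smul_add_map Literature.AlgebraicGeometry.Motives.AbelianVariety.isSmoothProjective_holds φ.hom.hom.hom
    (c := (d : ℝ)) (by exact_mod_cast hd)
  rw [Complex.ofReal_natCast, map_smul, smul_comm, ← smul_add] at h
  exact h

end Restrictions

/-! ## §3 The product class `π₀^* k + m·π₁^* k` on `⨁_{Fin 2} A` -/

section ProductClass

variable (A : AbelianVariety ℂ)

/-- The hyperplane class `e^* a` of the twelvefold is a non-zero real multiple of a Kähler class. -/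
theorem exists_isKaehlerClass_smul_hyperplane (hA : 0 < A.dim) (e : ProjectiveEmbedding (twelvefold A).X)
    {a : complexBetti (projectiveSpace e.n ℂ) 2} (ha : IsRationalClass a) (ha0 : a ≠ 0) :
    ∃ t : ℝ, t ≠ 0 ∧ IsKaehlerClass (twelvefold A).dim (twelvefold A).X ((t : ℂ) • complexBetti.map e.ι 2 a) := by
  have hX : IsSmoothProjective (twelvefold A).dim (twelvefold A).X :=
    Literature.AlgebraicGeometry.Motives.AbelianVariety.isSmoothProjective_holds
  have hB : 0 < (twelvefold A).dim := by
    change 0 < (⨁ (fun _ : Fin 2 => A)).dim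
    exact Literature.AlgebraicGeometry.Milne1999.dim_biproduct_pos _ hA
  obtain ⟨M⟩ := nonempty_hodgeModel_holds.nonempty hX
  obtain ⟨eR, heR, hem, -⟩ := exists_deRhamIsoFamily_holds M.model
  have hθ := M.fubiniStudyPullbackForm_mem_closedSmoothForms e.ι
  obtain ⟨H, hH⟩ := M.pullback_surjective 2 (ofRealClass M.carrier 2 (eR M.carrier 2
    (deRhamCohomology.mk ⟨fubiniStudyPullbackForm M.model e.ι M.toComplexPoints, hθ⟩)))
  have hK : M.IsKaehlerClassVia eR H := M.isKaehlerClassVia_of_pullback_eq_fubiniStudyPullbackForm eR hX _ hθ hH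
  obtain ⟨s, hs0, hs⟩ := exists_real_map_eq_smul_of_pullback_eq_fubiniStudy hX (Nat.one_le_iff_ne_zero.2 hB.ne')
    M e.ι eR heR hθ hH ha ha0
  refine ⟨s⁻¹, inv_ne_zero hs0, ?_⟩
  rw [hs, smul_smul, Complex.ofReal_inv, inv_mul_cancel₀ (Complex.ofReal_ne_zero.2 hs0), one_smul]
  exact hK.isKaehlerClass heR hem

/-- `ι₀^*(h₀ + σ^* h₀) = ι₀^* h₀ + ι₁^* h₀` and `ι₁^*(h₀ + σ^* h₀) = ι₀^* h₀ + ι₁^* h₀` (`ι₀ ≫ σ = ι₁`, `ι₁ ≫ σ = ι₀`). -/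
theorem map_ι_symmetrised (h₀ : complexBetti (twelvefold A).X 2) (j : Fin 2) :
    complexBetti.map (biproduct.ι (fun _ : Fin 2 => A) j).hom.hom.hom 2
        (h₀ + complexBetti.map (swapTwo A).hom.hom.hom 2 h₀) =
      complexBetti.map (biproduct.ι (fun _ : Fin 2 => A) 0).hom.hom.hom 2 h₀ +
        complexBetti.map (biproduct.ι (fun _ : Fin 2 => A) 1).hom.hom.hom 2 h₀ := by
  rw [map_add]
  change _ + singularCohomology.map ℂ ℂ _ 2 (singularCohomology.map ℂ ℂ _ 2 h₀) = _
  rw [abelianVarietyHom_map_map_apply]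
  fin_cases j
  · change complexBetti.map (biproduct.ι (fun _ : Fin 2 => A) 0).hom.hom.hom 2 h₀ +
        complexBetti.map (biproduct.ι (fun _ : Fin 2 => A) 0 ≫ swapTwo A).hom.hom.hom 2 h₀ = _
    rw [ι_zero_comp_swapTwo]
  · change complexBetti.map (biproduct.ι (fun _ : Fin 2 => A) 1).hom.hom.hom 2 h₀ +
        complexBetti.map (biproduct.ι (fun _ : Fin 2 => A) 1 ≫ swapTwo A).hom.hom.hom 2 h₀ = _
    rw [ι_one_comp_swapTwo, add_comm]

/-- The block-diagonal part of `h₀ + σ^* h₀` is `π₀^* κ + π₁^* κ`, `κ = ι₀^* h₀ + ι₁^* h₀`. -/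
theorem sum_map_blockProjection_symmetrised (h₀ : complexBetti (twelvefold A).X 2) :
    ∑ j, complexBetti.map (biproduct.π (fun _ : Fin 2 => A) j ≫ biproduct.ι (fun _ : Fin 2 => A) j).hom.hom.hom 2
        (h₀ + complexBetti.map (swapTwo A).hom.hom.hom 2 h₀) =
      complexBetti.map (biproduct.π (fun _ : Fin 2 => A) 0).hom.hom.hom 2
          (complexBetti.map (biproduct.ι (fun _ : Fin 2 => A) 0).hom.hom.hom 2 h₀ +
            complexBetti.map (biproduct.ι (fun _ : Fin 2 => A) 1).hom.hom.hom 2 h₀) +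
        complexBetti.map (biproduct.π (fun _ : Fin 2 => A) 1).hom.hom.hom 2
          (complexBetti.map (biproduct.ι (fun _ : Fin 2 => A) 0).hom.hom.hom 2 h₀ +
            complexBetti.map (biproduct.ι (fun _ : Fin 2 => A) 1).hom.hom.hom 2 h₀) := by
  rw [Literature.AlgebraicGeometry.Deligne1982.sum_map_blockProjection_eq_sumPolarizationClass,
    Literature.AlgebraicGeometry.Milne1999.sumPolarizationClass_def, Fin.sum_univ_two, map_ι_symmetrised,
    map_ι_symmetrised]

/-- `shift^* (π₀^* κ + π₁^* κ) = π₁^* κ` (`shift ≫ π₀ = π₁`, `shift ≫ π₁ = 0`, and `0^* = 0` on `H²`). -/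
theorem map_shiftTwo_sum (κ : complexBetti A.X 2) :
    complexBetti.map (shiftTwo A).hom.hom.hom 2
        (complexBetti.map (biproduct.π (fun _ : Fin 2 => A) 0).hom.hom.hom 2 κ +
          complexBetti.map (biproduct.π (fun _ : Fin 2 => A) 1).hom.hom.hom 2 κ) =
      complexBetti.map (biproduct.π (fun _ : Fin 2 => A) 1).hom.hom.hom 2 κ := by
  rw [map_add]
  change singularCohomology.map ℂ ℂ _ 2 (singularCohomology.map ℂ ℂ _ 2 κ) +
    singularCohomology.map ℂ ℂ _ 2 (singularCohomology.map ℂ ℂ _ 2 κ) = _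
  rw [abelianVarietyHom_map_map_apply, abelianVarietyHom_map_map_apply, shiftTwo_π_zero, shiftTwo_π_one]
  change complexBetti.map (biproduct.π (fun _ : Fin 2 => A) 1).hom.hom.hom 2 κ +
    complexBetti.map (0 : twelvefold A ⟶ A).hom.hom.hom 2 κ = _
  rw [Literature.AlgebraicGeometry.Deligne1982.complexBetti_map_zero_two, add_zero]

/-- `(φ ⊕ φ)^* (π₀^* κ + m·π₁^* κ) = π₀^* (φ^* κ) + m·π₁^* (φ^* κ)` on `H²`. -/
theorem map_phiTwo_prodClass (φ : A ⟶ A) (m : ℂ) (κ : complexBetti A.X 2) :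
    complexBetti.map (phiTwo A φ).hom.hom.hom 2
        (complexBetti.map (biproduct.π (fun _ : Fin 2 => A) 0).hom.hom.hom 2 κ +
          m • complexBetti.map (biproduct.π (fun _ : Fin 2 => A) 1).hom.hom.hom 2 κ) =
      complexBetti.map (biproduct.π (fun _ : Fin 2 => A) 0).hom.hom.hom 2 (complexBetti.map φ.hom.hom.hom 2 κ) +
        m • complexBetti.map (biproduct.π (fun _ : Fin 2 => A) 1).hom.hom.hom 2 (complexBetti.map φ.hom.hom.hom 2 κ) := by
  rw [map_add, map_smul]
  erw [Literature.AlgebraicGeometry.Pohlmann1968.map_biproductMap_map_π (fun _ : Fin 2 => A) (fun _ => φ) 0 2 κ,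
    Literature.AlgebraicGeometry.Pohlmann1968.map_biproductMap_map_π (fun _ : Fin 2 => A) (fun _ => φ) 1 2 κ]

variable {A}

/-- **The product class `h₂ = π₀^* k + m·π₁^* k`, `k = d·κ + φ^*κ`, `κ = ι₀^*(e^*a) + ι₁^*(e^*a)`, is a non-zero real
multiple of a Kähler class of `⨁_{Fin 2} A`** (`m ≥ 2`, `d ≥ 1`, `a ≠ 0` rational). Chain: `e^*a` (hyperplane) ⟶
`e^*a + σ^*e^*a` (`smul_add_map` along the swap) ⟶ block-diagonal part `π₀^*κ + π₁^*κ`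
(`isKaehlerClass_sum_map_blockProjection`) ⟶ `c·(π₀^*κ + π₁^*κ) + shift^*(π₀^*κ + π₁^*κ) = c·π₀^*κ + (c+1)·π₁^*κ =
c·(π₀^*κ + m·π₁^*κ)` with `c = 1/(m-1)` ⟶ `d·(π₀^*κ + m·π₁^*κ) + (φ⊕φ)^*(π₀^*κ + m·π₁^*κ) = h₂`. -/
theorem exists_isKaehlerClass_smul_prodClass (hA : 0 < A.dim) (φ : A ⟶ A) {d : ℕ} (hd : 0 < d) {m : ℕ} (hm : 2 ≤ m)
    (e : ProjectiveEmbedding (twelvefold A).X) {a : complexBetti (projectiveSpace e.n ℂ) 2} (ha : IsRationalClass a)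
    (ha0 : a ≠ 0) :
    ∃ t : ℝ, t ≠ 0 ∧ IsKaehlerClass (twelvefold A).dim (twelvefold A).X ((t : ℂ) •
      (complexBetti.map (biproduct.π (fun _ : Fin 2 => A) 0).hom.hom.hom 2
          ((d : ℂ) • (complexBetti.map (biproduct.ι (fun _ : Fin 2 => A) 0).hom.hom.hom 2 (complexBetti.map e.ι 2 a) +
              complexBetti.map (biproduct.ι (fun _ : Fin 2 => A) 1).hom.hom.hom 2 (complexBetti.map e.ι 2 a)) +
            complexBetti.map φ.hom.hom.hom 2
              (complexBetti.map (biproduct.ι (fun _ : Fin 2 => A) 0).hom.hom.hom 2 (complexBetti.map e.ι 2 a) +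
                complexBetti.map (biproduct.ι (fun _ : Fin 2 => A) 1).hom.hom.hom 2 (complexBetti.map e.ι 2 a))) +
        (m : ℂ) • complexBetti.map (biproduct.π (fun _ : Fin 2 => A) 1).hom.hom.hom 2
          ((d : ℂ) • (complexBetti.map (biproduct.ι (fun _ : Fin 2 => A) 0).hom.hom.hom 2 (complexBetti.map e.ι 2 a) +
              complexBetti.map (biproduct.ι (fun _ : Fin 2 => A) 1).hom.hom.hom 2 (complexBetti.map e.ι 2 a)) +
            complexBetti.map φ.hom.hom.hom 2
              (complexBetti.map (biproduct.ι (fun _ : Fin 2 => A) 0).hom.hom.hom 2 (complexBetti.map e.ι 2 a) +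
                complexBetti.map (biproduct.ι (fun _ : Fin 2 => A) 1).hom.hom.hom 2 (complexBetti.map e.ι 2 a))))) := by
  have hX : IsSmoothProjective (twelvefold A).dim (twelvefold A).X :=
    Literature.AlgebraicGeometry.Motives.AbelianVariety.isSmoothProjective_holds
  set h₀ : complexBetti (twelvefold A).X 2 := complexBetti.map e.ι 2 a with hh₀
  set κ : complexBetti A.X 2 := complexBetti.map (biproduct.ι (fun _ : Fin 2 => A) 0).hom.hom.hom 2 h₀ +
    complexBetti.map (biproduct.ι (fun _ : Fin 2 => A) 1).hom.hom.hom 2 h₀ with hκ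
  set X : complexBetti (twelvefold A).X 2 := complexBetti.map (biproduct.π (fun _ : Fin 2 => A) 0).hom.hom.hom 2 κ +
    complexBetti.map (biproduct.π (fun _ : Fin 2 => A) 1).hom.hom.hom 2 κ with hXdef
  set Y : complexBetti (twelvefold A).X 2 := complexBetti.map (biproduct.π (fun _ : Fin 2 => A) 0).hom.hom.hom 2 κ +
    (m : ℂ) • complexBetti.map (biproduct.π (fun _ : Fin 2 => A) 1).hom.hom.hom 2 κ with hYdef
  -- `s • h₀` is Kähler
  obtain ⟨s, hs0, hsK⟩ := exists_isKaehlerClass_smul_hyperplane A hA e ha ha0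
  -- `s • (h₀ + σ^* h₀)` is Kähler
  have h1 : IsKaehlerClass (twelvefold A).dim (twelvefold A).X ((s : ℂ) • (h₀ + complexBetti.map (swapTwo A).hom.hom.hom 2 h₀)) := by
    have h := hsK.smul_add_map hX (swapTwo A).hom.hom.hom (c := 1) one_pos
    rwa [Complex.ofReal_one, one_smul, map_smul, ← smul_add] at h
  -- `s • X` is Kähler (block-diagonal part)
  have h2 : IsKaehlerClass (twelvefold A).dim (twelvefold A).X ((s : ℂ) • X) := by
    have h := Literature.AlgebraicGeometry.Deligne1982.isKaehlerClass_sum_map_blockProjection (fun _ : Fin 2 => A) h1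
    simp only [map_smul] at h
    rw [← Finset.smul_sum, sum_map_blockProjection_symmetrised] at h
    exact h
  -- `(s c) • Y` is Kähler, `c = 1/(m-1)`
  have hm1 : (0 : ℝ) < (m : ℝ) - 1 := by
    have : (2 : ℝ) ≤ m := by exact_mod_cast hm
    linarith
  have h3 : IsKaehlerClass (twelvefold A).dim (twelvefold A).X (((s * ((m : ℝ) - 1)⁻¹ : ℝ) : ℂ) • Y) := by
    have h := h2.smul_add_map hX (shiftTwo A).hom.hom.hom (c := ((m : ℝ) - 1)⁻¹) (inv_pos.2 hm1)
    rw [map_smul, hXdef, map_shiftTwo_sum] at h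
    have e1 : ((((m : ℝ) - 1)⁻¹ : ℝ) : ℂ) • (s : ℂ) • (complexBetti.map (biproduct.π (fun _ : Fin 2 => A) 0).hom.hom.hom 2 κ +
          complexBetti.map (biproduct.π (fun _ : Fin 2 => A) 1).hom.hom.hom 2 κ) +
        (s : ℂ) • complexBetti.map (biproduct.π (fun _ : Fin 2 => A) 1).hom.hom.hom 2 κ =
        (((s * ((m : ℝ) - 1)⁻¹ : ℝ)) : ℂ) • Y := by
      have hm1' : ((m : ℂ) - 1) ≠ 0 := by
        rw [show ((m : ℂ) - 1) = (((m : ℝ) - 1 : ℝ) : ℂ) by push_cast; ring]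
        exact Complex.ofReal_ne_zero.2 hm1.ne'
      rw [hYdef]
      push_cast
      match_scalars
      · field_simp
      · field_simp
        ring
    rw [e1] at h
    exact h
  -- `(s c) • h₂ = d • ((s c) • Y) + (φ ⊕ φ)^* ((s c) • Y)` is Kähler
  refine ⟨s * ((m : ℝ) - 1)⁻¹, mul_ne_zero hs0 (inv_ne_zero hm1.ne'), ?_⟩
  have h := h3.smul_add_map hX (phiTwo A φ).hom.hom.hom (c := (d : ℝ)) (by exact_mod_cast hd)
  rw [Complex.ofReal_natCast, map_smul, hYdef, map_phiTwo_prodClass, smul_comm, ← smul_add] at h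
  have e3 : complexBetti.map (biproduct.π (fun _ : Fin 2 => A) 0).hom.hom.hom 2 ((d : ℂ) • κ + complexBetti.map φ.hom.hom.hom 2 κ) +
        (m : ℂ) • complexBetti.map (biproduct.π (fun _ : Fin 2 => A) 1).hom.hom.hom 2
          ((d : ℂ) • κ + complexBetti.map φ.hom.hom.hom 2 κ) =
      (d : ℂ) • (complexBetti.map (biproduct.π (fun _ : Fin 2 => A) 0).hom.hom.hom 2 κ +
        (m : ℂ) • complexBetti.map (biproduct.π (fun _ : Fin 2 => A) 1).hom.hom.hom 2 κ) +
      (complexBetti.map (biproduct.π (fun _ : Fin 2 => A) 0).hom.hom.hom 2 (complexBetti.map φ.hom.hom.hom 2 κ) +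
        (m : ℂ) • complexBetti.map (biproduct.π (fun _ : Fin 2 => A) 1).hom.hom.hom 2 (complexBetti.map φ.hom.hom.hom 2 κ)) := by
    simp only [map_add, map_smul]
    module
  rw [e3]
  exact h

end ProductClass

end Summit.HodgeConjecture.HodgeConjecture.BiquadraticSecantLift
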